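import Mathlib
import HarnessLib
import HarnessLib.Audit
import Summits.PneNP.Statement
import Literature.Computability.Complexity.Space
import HarnessLib.Audit.Status.Attr

/-!
Route: BorrowedMemory

DORMANT since 2026-08-24T09:05:31Z (reconciler: no traction for 6.6 d (last activity item-evidence-added at 2026-08-17T16:55:16Z); parked, not closed — `ledger route dormant route-PneNP-BorrowedMemory --off` to reactivate) — unstaffed, not closed; items shared with open routes are served there. `ledger route dormant <id> --off` reactivates.

# Route BorrowedMemory — P ≠ NP if polynomial time runs on borrowed memory but NP does not —
catalytic logspace (Buhrman–Cleve–Koucký–Loff–Speelman) as the capture class, open against P in both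
directions

X = X₁ ∧ X₂ ("it suffices to show"). A CATALYTIC LOGSPACE machine
(Buhrman–Cleve–Koucký–Loff–Speelman, STOC 2014,
doi:10.1145/2591796.2591874) has O(log n) clean work space and one polynomial-length auxiliary
memory that is handed over FULL
with an arbitrary content τ and must be returned bit-for-bit unchanged at the end; CL is the class
of languages so decidable (no time
bound). Known: TC¹ ⊆ CL ⊆ ZPP (BCKLS 2014), bipartite matching, linear matroid intersection and
maximum matching are in CL
(arXiv:2504.09991, arXiv:2509.06435, arXiv:2604.24275), and "the key open problem [is] the
relationship of CL to P" — neither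
CL ⊆ P nor P ⊆ CL is known (arXiv:2504.17412 §1.1). X₁ (PolyTimeIsCatalytic): P ⊆ CL — every
language of Cook's class P is decided by
a catalytic logspace machine (equivalently, CL being closed under logspace reductions, the circuit
value problem is in CL).
X₂ (NPNotCatalytic): NP ⊄ CL — some language of Cook's class NP (`PNPWave0.NP Bool`, the summit's
own class) is decided by no
catalytic logspace machine; in print this is SAT ∉ CL (CL is closed under logspace reductions, BCKLS
2014, and SAT is NP-complete under
them), and it is typed witness-free so that the deciding theorem is pure logic over the Statement's
two classes and the route file imports
`Space.lean` alone (rev 1, cone repair: the rev-0 form `SatNotCatalytic` needed the model bridge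
`np_bool_eq` and `SAT_mem_NP_holds`, whose
modules import `ClayProblem.lean` and with it the open conjecture `NPNotSubsetPPoly` — never used,
but in the import cone). Since CL is not
known to lie inside P, X₂ is NOT a consequence of P ≠ NP (it sits below NP ⊄ ZPP and is incomparable
with the summit), and X₁ is not a
consequence of P = NP: both halves are logically independent of the Statement, and together they
decide it. CL is typed INLINE over the tree's read-only-input stack machines
(`Literature.Computability.Complexity.
SpaceMachine`, Space.lean): two extra binary stacks form the catalytic tape, loaded with an
arbitrary τ of length p(|x|) and restored at
the halting configuration; clean space ≤ c·log₂|x| + c, catalytic length ≤ p(|x|) + c throughout. No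
idea card is realised (nearest:
ppst-catalytic-alternation, an alternation SPEED-UP card — different mechanism).
Lean: `(let InCL : Language Bool → Prop := fun L => ∃ (M :
Literature.Computability.Complexity.SpaceMachine Bool Bool) (kA kB : M.tm.K) (eA : M.tm.Γ kA ≃ Bool)
(_eB : M.tm.Γ kB ≃ Bool) (c : ℕ) (p : Polynomial ℕ), kA ≠ M.tm.k₀ ∧ kA ≠ M.tm.k₁ ∧ kA ≠ M.kL ∧ kB ≠
M.tm.k₀ ∧ kB ≠ M.tm.k₁ ∧ kB ≠ M.kL ∧ kA ≠ kB ∧ ∀ (x : List Bool) (τ : List Bool), τ.length = p.eval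
x.length → haveI := M.tm.kDecidableEq; haveI := M.tm.kFin; let start : M.tm.Cfg := ⟨(M.init x).l,
(M.init x).var, Function.update (M.init x).stk kA (τ.map eA.symm)⟩; (∀ cfg : M.tm.Cfg,
StateTransition.Reaches M.tm.step start cfg → ((cfg.stk M.kL).map M.leftAlphabet).reverse ++
(cfg.stk M.tm.k₀).map M.inputAlphabet = x ∧ (∑ k ∈ (((Finset.univ.erase M.tm.k₀).erase M.kL).erase
kA).erase kB, (cfg.stk k).length) ≤ c * Nat.log 2 x.length + c ∧ (cfg.stk kA).length + (cfg.stk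
kB).length ≤ p.eval x.length + c) ∧ (∃ cfg : M.tm.Cfg, cfg ∈ StateTransition.eval M.tm.step start ∧
(x ∈ L → (cfg.stk M.tm.k₁).map M.outputAlphabet = [true]) ∧ (x ∉ L → (cfg.stk M.tm.k₁).map
M.outputAlphabet = [false]) ∧ cfg.stk kA = τ.map eA.symm ∧ cfg.stk kB = []); ∀ L : Language Bool, L
∈ Literature.Computability.Complexity.PNPWave0.P Bool → InCL L) ∧ (let InCL : Language Bool → Prop
:= fun L => ∃ (M : Literature.Computability.Complexity.SpaceMachine Bool Bool) (kA kB : M.tm.K) (eA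
: M.tm.Γ kA ≃ Bool) (_eB : M.tm.Γ kB ≃ Bool) (c : ℕ) (p : Polynomial ℕ), kA ≠ M.tm.k₀ ∧ kA ≠ M.tm.k₁
∧ kA ≠ M.kL ∧ kB ≠ M.tm.k₀ ∧ kB ≠ M.tm.k₁ ∧ kB ≠ M.kL ∧ kA ≠ kB ∧ ∀ (x : List Bool) (τ : List Bool),
τ.length = p.eval x.length → haveI := M.tm.kDecidableEq; haveI := M.tm.kFin; let start : M.tm.Cfg :=
⟨(M.init x).l, (M.init x).var, Function.update (M.init x).stk kA (τ.map eA.symm)⟩; (∀ cfg :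
M.tm.Cfg, StateTransition.Reaches M.tm.step start cfg → ((cfg.stk M.kL).map M.leftAlphabet).reverse
++ (cfg.stk M.tm.k₀).map M.inputAlphabet = x ∧ (∑ k ∈ (((Finset.univ.erase M.tm.k₀).erase
M.kL).erase kA).erase kB, (cfg.stk k).length) ≤ c * Nat.log 2 x.length + c ∧ (cfg.stk kA).length +
(cfg.stk kB).length ≤ p.eval x.length + c) ∧ (∃ cfg : M.tm.Cfg, cfg ∈ StateTransition.eval M.tm.step
start ∧ (x ∈ L → (cfg.stk M.tm.k₁).map M.outputAlphabet = [true]) ∧ (x ∉ L → (cfg.stk M.tm.k₁).map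
M.outputAlphabet = [false]) ∧ cfg.stk kA = τ.map eA.symm ∧ cfg.stk kB = []); ∃ L : Language Bool, L
∈ Literature.Computability.Complexity.PNPWave0.NP Bool ∧ ¬ InCL L)`

## Assembly
Pure logic, no Literature fact (sorry-free: Sketch.lean / glue.lean, rc 0, axioms
propext/choice/Quot.sound): take the witness L of
NPNotCatalytic (L ∈ PNPWave0.NP Bool, L ∉ CL); assume ¬PneNP, i.e. every language of PNPWave0.NP
Bool lies in PNPWave0.P Bool; then L ∈ P,
hence L ∈ CL by PolyTimeIsCatalytic — contradiction. The deciding theorem `closes (h₁ :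
PolyTimeIsCatalytic) (h₂ : NPNotCatalytic) : PneNP`
is that argument (both binders load-bearing); the assembly item records the same implication and is
provable now (`assembly_holds :=
closes`).

Rationale: WHY THIS LINE. Mechanism: capture P ≠ NP between a SIMULATION statement "P ⊆ M" and a LOWER BOUND
"NP ⊄ M" (in print: SAT ∉ M) for an intermediate class M whose power
relative to P is open — but, unlike every capture route on this summit (extended monotone circuits,
symmetric circuits in a window,
CPT+Card, descent/consistency levels), take for M a uniform MACHINE class defined by a conservation
law (the borrowed memory must come
back intact) that is NOT known to sit inside P: CL ⊆ ZPP only, so the lower-bound half is weaker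
than NP ⊄ ZPP instead of being SAT ∉ P
reworded, and the simulation half is a live algorithmic programme with two engines — algebraic
register programs over rings (TC¹ ⊆ CL,
BCKLS 2014; SAC²/matrix powering beyond log-depth, arXiv:2504.17412) and compress-or-compute /
isolation (matching and matroid
intersection in CL, arXiv:2504.09991, arXiv:2509.06435, arXiv:2604.24275; the collapses CNL = CL and
randomized CL = CL, arXiv:2504.08444),
the same space-reuse technology behind Cook–Mertz tree evaluation and Williams' DTIME(t) ⊆
DSPACE(√(t log t)) (arXiv:2502.17779).
Imported area: space-bounded / catalytic computation (2014–2026), absent from all 51 PneNP routes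
(grep of Theses: 0 hits) and from the
negatives index. What P = NP would contradict here is not a lower bound we cannot approach but the
conjunction of two statements each
consistent with P = NP on its own: if P = NP then NP = P ⊆ CL by X₁, against X₂.

RANKED CRUXES. #2 PolyTimeIsCatalytic (crux) — P ⊆ CL — every language in Cook's P (`PNPWave0.P
Bool`, FinTM2 polynomial time) is decided by a catalytic logspace machine: an input-preserving
`SpaceMachine` with two extra binary stacks kA, kB carrying an arbitrary initial content τ, |τ| =
p(|x|), that is restored at the halting configuration, with clean space ≤ c·log₂|x| + c and
catalytic length ≤ p(|x|) + c along the run (BCKLS 2014; the P-versus-CL question, arXiv:2504.17412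
§1.1). [difficulty: open-problem] (why it might fail: CL ⊆ ZPP and CL reduces to LOSSY coding
(Cook–Li–Mertz–Pyne); the frontier is only NC² vs CL (arXiv:2504.17412); a theorem CL ⊆ SC, CL ⊆ NC
or "CVP ∉ CL", or an oracle-free structural obstruction to composing catalytic subroutines beyond
log depth, kills it.) [doi:10.1145/2591796.2591874, arXiv:2504.17412, arXiv:2504.09991,
arXiv:2509.06435, arXiv:2604.24275, arXiv:2504.08444]
#3 NPNotCatalytic (crux) — NP ⊄ CL: some language of Cook's NP (`PNPWave0.NP Bool`) is not decidable
by any catalytic logspace machine (same inline CL); in print equivalent to SAT ∉ CL (CL is closed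
under logspace reductions, BCKLS 2014; SAT is NP-complete under logspace reductions), typed
witness-free (rev 1: replaces the rev-0 crux `SatNotCatalytic` = SAT ∉ CL, so that neither the model
bridge nor Cook–Levin enters the route file). Below NP ⊄ ZPP (CL ⊆ ZPP), incomparable with P ≠ NP
because CL ⊆ P is open; relative to a PSPACE-complete oracle it fails, so any proof is
non-relativizing. [difficulty: open-problem] (why it might fail: no lower-bound technique for CL
exists (even QBF ∉ CL is unproved: CL ⊆ ZPP ⊆ PSPACE, ZPP vs PSPACE open); NP ⊆ CL 'only' yields NP
⊆ ZPP; nonuniform catalytic branching programs compute everything in amortized linear size (Potechin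
2017), so uniformity/exact restoration must be used.) [doi:10.1145/2591796.2591874,
doi:10.1007/s00224-017-9784-7, arXiv:2504.08444, arXiv:2409.05046]
#9 CatalyticSanity (support) — the inline class computes: the empty language and the full language
are in CL (two one-step machines over five stacks; validates the halting / restoration / space
clauses of the inline definition, cf. `cptCardDefinable_univ` for CPT+Card). [difficulty:
provable-now] [doi:10.1145/2591796.2591874, AroraBarak2009]
#9 LogspaceIsCatalytic (support) — LOGSPACE ⊆ CL for the inline class (a log-space `SpaceMachine`
decider, given two idle extra binary stacks, is a catalytic decider with p = |τ| untouched) — the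
trivial direction of BCKLS's L ⊆ CL ⊆ ZPP, a machine-surgery lemma over `SpaceMachine`. [difficulty:
M] [doi:10.1145/2591796.2591874, AroraBarak2009]

TWO-LAYER PLAN. Foreseen glued splits (the BC3 birth skeletons, filed only after a crux moves):
PolyTimeIsCatalytic ⇐ ClosureUnderLogspaceReductions
(BCKLS: recompute bits of f(x) in clean logspace, share the catalytic tape; provable-now, M/L) →
HardLanguageIsCatalytic (some
logspace-hard language for P, e.g. circuit value, is in CL — the content) → PolyTimeIsCatalytic.
NPNotCatalytic ⇐ SatNotCLP (SAT ∉
poly-TIME catalytic logspace CLP ⊆ P; a consequence of the summit, attackable as a time–space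
trade-off WITH restoration) →
SatCatalyticIsPolytime (a catalytic SAT decider can be made worst-case polynomial-time — the SAT
instance of the open CL = CLP question;
compress-or-compute gives it on average over τ) → NPNotCatalytic (the glue uses SAT ∈ PNPWave0.NP
Bool, already proved in the tree as
`feige_satMemNPCook_proof`; cone hygiene: Theorems files for this route should reach the Cook
classes through the conjecture-free
`CookBridges.lean`, never through NPBridge/ClayProblem*, until the interim duplicate
`NPNotSubsetPPoly` of ClayProblem.lean is deleted).

KILL CRITERIA. PolyTimeIsCatalytic refuted (an explicit language of P provably outside CL — itself a
major theorem) closes the route (`close --reason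
refuted:PolyTimeIsCatalytic`); no repair by enlarging M is intended (that would be a new route).
NPNotCatalytic refuted = NP ⊆ CL (equivalently SAT ∈ CL), hence
NP ⊆ ZPP: route closed, and it is news. A theorem CL = P turns X₂ into NP ⊄ P, the Statement itself
(the route becomes a restatement — retire `not-a-thesis`);
a theorem CL ⊆ P (e.g. CL = CLP) leaves the route standing but demotes X₂ to a consequence of the
summit (record in the header). A proof
that the inline class is trivial/empty (CatalyticSanity refuted) is a TYPING error: restate both
cruxes over the repaired class (one
repair), the line is untouched.

NOT DECOMPOSED YET. Which P-hard problem carries X₁ first (circuit value vs Horn-SAT vs LP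
feasibility; all logspace-complete for P), the register-program vs
compression dichotomy inside X₁, the catalytic-length regime p(n) = n^k (immaterial for CL), the
randomized / nondeterministic variants
(all equal CL by arXiv:2504.08444, so no separate items), a named Literature definition `CSPACE s c`
replacing the inline lets
(definition request below), the ZPP upper bound CL ⊆ ZPP as a vendored fact (not needed by
`closes`), and the SAT form of X₂ (SAT ∉ CL,
the rev-0 crux, replaced in rev 1 only to keep the import cone conjecture-free), which returns as
the children of X₂'s first split.

CHEAPEST FALSIFIER. (i) Vacuity audit of the inline CL (A1–A6): build the two one-step machines of
CatalyticSanity, or show the halting/restoration clause is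
unsatisfiable or trivially satisfiable — this checks the TYPING (the catalytic alphabets are pinned
to Bool so τ carries p(|x|) bits; the
second stack is Bool so no annotation trick adds clean memory; `eval` is deterministic so the
restored configuration is not chosen).
(ii) Lookup: any theorem placing CL inside a class believed properly inside P (NC, SC, polyL), or
oracle-free evidence for CVP ∉ CL —
searched arXiv "catalytic space/logspace" 2014–2026 (25 + 7 hits read by title, four papers opened):
none; the literature states CL vs P
open both ways (arXiv:2504.17412 §1.1, 2025). (iii) For X₂ the oracle with CL^A = PSPACE^A (BKLS,
doi:10.1007/s00224-017-9784-7) shows a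
proof must be non-relativizing — recorded in BARRIERS, not a kill.

NUMBERS. TC¹ ⊆ CL ⊆ ZPP (2014); SAC² ⊆ CSPACE(O(log²n / log log n), 2^(O(log^(1+ε) n)))
(arXiv:2504.17412 Thm 1.1); bipartite matching ∈ CL (2025),
linear matroid intersection ∈ CL (2025), maximum matching ∈ CL (2026); CNL = CL and C·BPL-type
classes = CL (arXiv:2504.08444);
DTIME(t) ⊆ DSPACE(√(t log t)) (arXiv:2502.17779). Alternation-free: no constant, threshold or
exponent is hand-picked in either crux.

DEFINITION REQUESTS. A Literature definition `Literature.Computability.Complexity.CSPACE (s c : ℕ →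
ℕ) : Set (Language Bool)` and `CL := ⋃ₖ CSPACE (log₂)
(n ↦ n^k)` over `SpaceMachine` matching the inline lets verbatim (so the four items can be restated
by name), with the sanity lemmas of
CatalyticSanity; cite facts wanted: BCKLS 2014 Thm (TC¹ ⊆ CL), Thm (CL ⊆ ZPP), closure of CL under
logspace reductions; KMPS 2025 (CNL = CL).

Novelty: Searches (2026-08-17): grep of all 56 `Summits/PneNP/PneNP/Theses/*.lean` for
catalytic|Catalytic|CSPACE (0 hits; nearest by topic
UniformStream = streaming space bound for MCSP under magnification,
ChoicelessCapture/ConvexRankGates/SymmetryBudget = capture template);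
Ideas index (102 cards): ppst-catalytic-alternation (alternation speed-up of DTIME, graded variant)
— no capture card; `lit search
--source arxiv` "catalytic logspace polynomial time" (7), "catalytic space" 2014– (25), "structure
of catalytic space ..." (rate-limited);
`lit galaxy search "capturing randomness and time via compression" --star all` (0); `lit read`
arXiv:2504.08444 pp 1–6, arXiv:2504.17412
pp 1–3, arXiv:2509.06209 pp 1–3, arXiv:2504.04416 (Oliveira, meta-mathematics column: the
conditional routes to P ≠ NP in print are EF
lower bounds + witnessing, taken by route FeasibleWitnessing); crossref for BCKLS14 / BKLS17 DOIs;
`ledger negatives --problem PneNP` (5,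
none space-bounded).
Nearest prior art found: doi:10.1145/2591796.2591874 (the model; TC¹ ⊆ CL ⊆ ZPP; poses CL vs P) and
arXiv:2504.17412 §1.1 (states the
two-sided openness of CL vs P in 2025); on the hub, route ChoicelessCapture (capture by CPT+Card,
whose ⊆ P direction is a theorem).
Delta: nobody has used the TWO-SIDED openness of CL versus P to cut P ≠ NP into two
summit-independent halves (P ⊆ CL, SAT ∉ CL); on this
hub it is the only capture line whose intermediate class is not known to lie inside P, so its
lower-bound crux is not SAT ∉ P  [refs: 10.1145/2591796.2591874, 2504.08444, 2504.17412, 2509.06209, 2504.04416, doi:10.1145/2591796.2591874]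

Barriers (technique_class: catalytic-space, capture-by-machine-class): - technique_class: catalytic-space, capture-by-machine-class
- Literature.Barriers.PneNP.Relativization: the implication X₁ ∧ X₂ → PneNP relativizes (oracle
stack machines, Ladner–Lynch query convention) and the summit does not, so at least one crux needs a
non-relativizing proof; concretely X₂ FAILS relative to a PSPACE-complete oracle (there L^A = P^A =
NP^A = PSPACE^A = CL^A; BKLS give CL^A = PSPACE^A, doi:10.1007/s00224-017-9784-7), while X₁ holds
there trivially. Evasion claimed for X₁ only in spirit: every catalytic simulation in print
(register programs over Z_m for TC¹, polynomial-method tree evaluation, isolation + compression for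
matching) is white-box/algebraic; for X₂: it does not; the bet is that exact restoration for all
2^p(n) contents is a counting/compression constraint (compress-or-compute) that plain space or time
bounds never offered.
- Literature.Barriers.PneNP.Algebrization: inherited by the conjunction exactly as relativization
(Aaronson–Wigderson: P vs NP needs non-algebrizing techniques); neither crux is an oracle statement
of AW's form, but an X₂ proof by a low-degree-extension-respecting simulation argument would
algebrize — conceded, no evasion claimed.
- Literature.Barriers.PneNP.NaturalProofs: X₂ is a lower bound against a UNIFORM class with a
semantic promise (restoration), not against P/poly; a proof that instead bounds nonuniform catalytic
branching programs would meet both Razborov–Rudich and Potechin's amortization theorem (every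
function ha

History (route lifecycle, newest last):
- 2026-08-17T03:50:46Z · rev 1: restated SatNotCatalytic (stmt-PneNP-18881), Assembly (stmt-PneNP-18884) — cone repair (rev 1): imports := [Space] (drop CNF, NegCNFTranscoder, NPBridge — they pull ClayProblem.lean and its open conjecture NPNotSubsetPPoly into the mod (planner-rrepair-PneNP-BorrowedMemory-9b46c52a-0)
- 2026-08-24T09:05:31Z · DORMANT — reconciler: no traction for 6.6 d (last activity item-evidence-added at 2026-08-17T16:55:16Z); parked, not closed — `ledger route dormant route-PneNP-BorrowedMe (operator:999:2462786)

sub-problem: PneNP · status: dormant · opened planner-plan-novel-PneNP-PneNP-1b2e912a-v2-g13-0 2026-08-17T03:05:16Z · rev 1 · ledger route-PneNP-BorrowedMemory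
GENERATED by the gate from the ledger (D-0016/17). Provers cite these decls: `theorem foo : Summit.PneNP.PneNP.Theses.BorrowedMemory.<Decl> := …` in Summits/PneNP/PneNP/Theorems/<Name>.lean.
-/

namespace Summit.PneNP.PneNP.Theses.BorrowedMemory

open scoped BigOperators Topology Manifold Classical MeasureTheory ProbabilityTheory Matrix InnerProductSpace ComplexConjugate ContinuousMap
open Filter Set Function TopologicalSpace MeasureTheory

attribute [summit_statement] _root_.PneNP

open Literature.PNP

/-- item stmt-PneNP-18880 · crux · rank 2 · open · by planner
why it might fail: CL ⊆ ZPP and CL reduces to LOSSY coding (Cook–Li–Mertz–Pyne); the frontier is only NC² vs CL (arXiv:2504.17412); a theorem CL ⊆ SC, CL ⊆ NC or "CVP ∉ CL", or an oracle-free structural obstruction to composing catalytic subroutines beyond log depth, kills it.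
sources: doi:10.1145/2591796.2591874, arXiv:2504.17412, arXiv:2504.09991, arXiv:2509.06435, arXiv:2604.24275, arXiv:2504.08444
[crux] P ⊆ CL — every language in Cook's P (`PNPWave0.P Bool`, FinTM2 polynomial time) is decided by
a catalytic logspace machine: an input-preserving `SpaceMachine` with two extra binary stacks kA, kB
carrying an arbitrary initial content τ, |τ| = p(|x|), that is restored at the halting
configuration, with clean space ≤ c·log₂|x| + c and catalytic length ≤ p(|x|) + c along the run
(BCKLS 2014; the P-versus-CL question, arXiv:2504.17412 §1.1). [difficulty: open-problem] -/
@[route_item "route-PneNP-BorrowedMemory", crux]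
def PolyTimeIsCatalytic : Prop :=
  let InCL : Language Bool → Prop := fun L => ∃ (M : Literature.Computability.Complexity.SpaceMachine Bool Bool) (kA kB : M.tm.K) (eA : M.tm.Γ kA ≃ Bool) (_eB : M.tm.Γ kB ≃ Bool) (c : ℕ) (p : Polynomial ℕ), kA ≠ M.tm.k₀ ∧ kA ≠ M.tm.k₁ ∧ kA ≠ M.kL ∧ kB ≠ M.tm.k₀ ∧ kB ≠ M.tm.k₁ ∧ kB ≠ M.kL ∧ kA ≠ kB ∧ ∀ (x : List Bool) (τ : List Bool), τ.length = p.eval x.length → haveI := M.tm.kDecidableEq; haveI := M.tm.kFin; let start : M.tm.Cfg := ⟨(M.init x).l, (M.init x).var, Function.update (M.init x).stk kA (τ.map eA.symm)⟩; (∀ cfg : M.tm.Cfg, StateTransition.Reaches M.tm.step start cfg → ((cfg.stk M.kL).map M.leftAlphabet).reverse ++ (cfg.stk M.tm.k₀).map M.inputAlphabet = x ∧ (∑ k ∈ (((Finset.univ.erase M.tm.k₀).erase M.kL).erase kA).erase kB, (cfg.stk k).length) ≤ c * Nat.log 2 x.length + c ∧ (cfg.stk kA).length + (cfg.stk kB).length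 ≤ p.eval x.length + c) ∧ (∃ cfg : M.tm.Cfg, cfg ∈ StateTransition.eval M.tm.step start ∧ (x ∈ L → (cfg.stk M.tm.k₁).map M.outputAlphabet = [true]) ∧ (x ∉ L → (cfg.stk M.tm.k₁).map M.outputAlphabet = [false]) ∧ cfg.stk kA = τ.map eA.symm ∧ cfg.stk kB = []); ∀ L : Language Bool, L ∈ Literature.Computability.Complexity.PNPWave0.P Bool → InCL L

/-- item stmt-PneNP-19091 · crux · rank 3 · open · by planner
why it might fail: no lower-bound technique for CL exists (even QBF ∉ CL is unproved: CL ⊆ ZPP ⊆ PSPACE, ZPP vs PSPACE open); NP ⊆ CL 'only' yields NP ⊆ ZPP; nonuniform catalytic branching programs compute everything in amortized linear size (Potechin 2017), so uniformity/exact restoration must be used.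
sources: doi:10.1145/2591796.2591874, doi:10.1007/s00224-017-9784-7, arXiv:2504.08444, arXiv:2409.05046
[crux] NP ⊄ CL — some language of Cook's NP (`PNPWave0.NP Bool`, the summit's own class) is not
decidable by any catalytic logspace machine (same inline CL: input-preserving `SpaceMachine`, two
extra binary stacks kA, kB loaded with an arbitrary τ, |τ| = p(|x|), restored at the halting
configuration, clean space ≤ c·log₂|x| + c, catalytic length ≤ p(|x|) + c). In print equivalent to
SAT ∉ CL (CL is closed under logspace reductions, BCKLS 2014; SAT is NP-complete under logspace
reductions); typed witness-free so that the deciding theorem is pure logic (rev 1 cone repair: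
replaces `SatNotCatalytic` = SAT ∉ CL). Below NP ⊄ ZPP (CL ⊆ ZPP), incomparable with P ≠ NP because
CL ⊆ P is open; fails relative to a PSPACE-complete oracle, so any proof is non-relativizing.
[difficulty: open-problem] -/
@[route_item "route-PneNP-BorrowedMemory", crux]
def NPNotCatalytic : Prop :=
  let InCL : Language Bool → Prop := fun L => ∃ (M : Literature.Computability.Complexity.SpaceMachine Bool Bool) (kA kB : M.tm.K) (eA : M.tm.Γ kA ≃ Bool) (_eB : M.tm.Γ kB ≃ Bool) (c : ℕ) (p : Polynomial ℕ), kA ≠ M.tm.k₀ ∧ kA ≠ M.tm.k₁ ∧ kA ≠ M.kL ∧ kB ≠ M.tm.k₀ ∧ kB ≠ M.tm.k₁ ∧ kB ≠ M.kL ∧ kA ≠ kB ∧ ∀ (x : List Bool) (τ : List Bool), τ.length = p.eval x.length → haveI := M.tm.kDecidableEq; haveI := M.tm.kFin; let start : M.tm.Cfg := ⟨(M.init x).l, (M.init x).var, Function.update (M.init x).stk kA (τ.map eA.symm)⟩; (∀ cfg : M.tm.Cfg, StateTransition.Reaches M.tm.step start cfg → ((cfg.stk M.kL).map M.leftAlphabet).reverse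 ++ (cfg.stk M.tm.k₀).map M.inputAlphabet = x ∧ (∑ k ∈ (((Finset.univ.erase M.tm.k₀).erase M.kL).erase kA).erase kB, (cfg.stk k).length) ≤ c * Nat.log 2 x.length + c ∧ (cfg.stk kA).length + (cfg.stk kB).length ≤ p.eval x.length + c) ∧ (∃ cfg : M.tm.Cfg, cfg ∈ StateTransition.eval M.tm.step start ∧ (x ∈ L → (cfg.stk M.tm.k₁).map M.outputAlphabet = [true]) ∧ (x ∉ L → (cfg.stk M.tm.k₁).map M.outputAlphabet = [false]) ∧ cfg.stk kA = τ.map eA.symm ∧ cfg.stk kB = []); ∃ L : Language Bool, L ∈ Literature.Computability.Complexity.PNPWave0.NP Bool ∧ ¬ InCL L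

/-- item stmt-PneNP-18882 · support · rank 9 · open · by planner
sources: doi:10.1145/2591796.2591874, AroraBarak2009
[support] the inline class computes: the empty language and the full language are in CL (two
one-step machines over five stacks; validates the halting / restoration / space clauses of the
inline definition, cf. `cptCardDefinable_univ` for CPT+Card). [difficulty: provable-now] -/
@[route_item "route-PneNP-BorrowedMemory"]
def CatalyticSanity : Prop :=
  let InCL : Language Bool → Prop := fun L => ∃ (M : Literature.Computability.Complexity.SpaceMachine Bool Bool) (kA kB : M.tm.K) (eA : M.tm.Γ kA ≃ Bool) (_eB : M.tm.Γ kB ≃ Bool) (c : ℕ) (p : Polynomial ℕ), kA ≠ M.tm.k₀ ∧ kA ≠ M.tm.k₁ ∧ kA ≠ M.kL ∧ kB ≠ M.tm.k₀ ∧ kB ≠ M.tm.k₁ ∧ kB ≠ M.kL ∧ kA ≠ kB ∧ ∀ (x : List Bool) (τ : List Bool), τ.length = p.eval x.length → haveI := M.tm.kDecidableEq; haveI := M.tm.kFin; let start : M.tm.Cfg := ⟨(M.init x).l, (M.init x).var, Function.update (M.init x).stk kA (τ.map eA.symm)⟩; (∀ cfg : M.tm.Cfg, StateTransition.Reaches M.tm.step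 start cfg → ((cfg.stk M.kL).map M.leftAlphabet).reverse ++ (cfg.stk M.tm.k₀).map M.inputAlphabet = x ∧ (∑ k ∈ (((Finset.univ.erase M.tm.k₀).erase M.kL).erase kA).erase kB, (cfg.stk k).length) ≤ c * Nat.log 2 x.length + c ∧ (cfg.stk kA).length + (cfg.stk kB).length ≤ p.eval x.length + c) ∧ (∃ cfg : M.tm.Cfg, cfg ∈ StateTransition.eval M.tm.step start ∧ (x ∈ L → (cfg.stk M.tm.k₁).map M.outputAlphabet = [true]) ∧ (x ∉ L → (cfg.stk M.tm.k₁).map M.outputAlphabet = [false]) ∧ cfg.stk kA = τ.map eA.symm ∧ cfg.stk kB = []); InCL (∅ : Set (List Bool)) ∧ InCL (Set.univ : Set (List Bool))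

/-- item stmt-PneNP-18883 · support · rank 9 · open · by planner
sources: doi:10.1145/2591796.2591874, AroraBarak2009
[support] LOGSPACE ⊆ CL for the inline class (a log-space `SpaceMachine` decider, given two idle
extra binary stacks, is a catalytic decider with p = |τ| untouched) — the trivial direction of
BCKLS's L ⊆ CL ⊆ ZPP, a machine-surgery lemma over `SpaceMachine`. [difficulty: M] -/
@[route_item "route-PneNP-BorrowedMemory"]
def LogspaceIsCatalytic : Prop :=
  let InCL : Language Bool → Prop := fun L => ∃ (M : Literature.Computability.Complexity.SpaceMachine Bool Bool) (kA kB : M.tm.K) (eA : M.tm.Γ kA ≃ Bool) (_eB : M.tm.Γ kB ≃ Bool) (c : ℕ) (p : Polynomial ℕ), kA ≠ M.tm.k₀ ∧ kA ≠ M.tm.k₁ ∧ kA ≠ M.kL ∧ kB ≠ M.tm.k₀ ∧ kB ≠ M.tm.k₁ ∧ kB ≠ M.kL ∧ kA ≠ kB ∧ ∀ (x : List Bool) (τ : List Bool), τ.length = p.eval x.length → haveI := M.tm.kDecidableEq; haveI := M.tm.kFin; let start : M.tm.Cfg := ⟨(M.init x).l, (M.init x).var, Function.update (M.init x).stk kA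 (τ.map eA.symm)⟩; (∀ cfg : M.tm.Cfg, StateTransition.Reaches M.tm.step start cfg → ((cfg.stk M.kL).map M.leftAlphabet).reverse ++ (cfg.stk M.tm.k₀).map M.inputAlphabet = x ∧ (∑ k ∈ (((Finset.univ.erase M.tm.k₀).erase M.kL).erase kA).erase kB, (cfg.stk k).length) ≤ c * Nat.log 2 x.length + c ∧ (cfg.stk kA).length + (cfg.stk kB).length ≤ p.eval x.length + c) ∧ (∃ cfg : M.tm.Cfg, cfg ∈ StateTransition.eval M.tm.step start ∧ (x ∈ L → (cfg.stk M.tm.k₁).map M.outputAlphabet = [true]) ∧ (x ∉ L → (cfg.stk M.tm.k₁).map M.outputAlphabet = [false]) ∧ cfg.stk kA = τ.map eA.symm ∧ cfg.stk kB = []); ∀ L : Language Bool, L ∈ Literature.Computability.Complexity.LOGSPACE → InCL L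

-- earlier Assembly (stmt-PneNP-18884, replaced 2026-08-17T03:50:46Z -> stmt-PneNP-19092): retired by None — PolyTimeIsCatalytic → SatNotCatalytic → PneNP
/-- item stmt-PneNP-19092 · assembly · rank 1 · open · by planner
sources: doi:10.1145/2591796.2591874, Cook1971
[assembly] PolyTimeIsCatalytic → NPNotCatalytic → PneNP (the deciding theorem `closes`, pure logic). -/
@[route_item "route-PneNP-BorrowedMemory"]
def Assembly : Prop :=
  PolyTimeIsCatalytic → NPNotCatalytic → PneNP

-- records of items no longer active in this route (dropped / restated):
-- earlier SatNotCatalytic (stmt-PneNP-18881, replaced 2026-08-17T03:50:46Z -> stmt-PneNP-19091): retired by None — let InCL : Language Bool → Prop := fun L => ∃ (M : Literature.Computability.Complexity.SpaceMachine Bool Bool) (kA kB : M.tm.K) (eA : M.tm.Γ kA ≃ Bool) (_eB : M.tm.Γ kB ≃ Bool) (c : ℕ) (p : Polynomial ℕ), kA ≠ M.tm.k₀ ∧ kA ≠ M.tm.k₁ ∧ kA ≠ M.kL ∧ kB ≠ M.tm.k₀ ∧ kB ≠ M.tm.k₁ ∧ kB ≠ M.kL 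

/-! D-0027 §2.1 — DECIDING THEOREM (planner-authored via `route open/edit --closes-file`; by planner-rrepair-PneNP-BorrowedMemory-9b46c52a-0 2026-08-17T03:50:46Z):
its hypotheses are this route's items and its conclusion the sub-problem Statement (glue_lint), and it elaborates with this file. -/

@[closes "route-PneNP-BorrowedMemory"] theorem closes (h₁ : PolyTimeIsCatalytic) (h₂ : NPNotCatalytic) : PneNP := by
  obtain ⟨L, hNP, hCL⟩ := h₂
  by_contra hS
  have hP : L ∈ Literature.Computability.Complexity.PNPWave0.P Bool := by
    by_contra hP
    exact hS ⟨L, hNP, hP⟩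
  exact hCL (h₁ L hP)

end Summit.PneNP.PneNP.Theses.BorrowedMemory
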